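import Literature.NumberTheory.Automorphic.UnitaryRankThreeTorus
import HarnessLib

/-!
# Rank-3 isotropic unitary groups, III: the parabolic step, the big cell, and `SU ≤ ker χ`

Topic `NumberTheory/Automorphic`; namespace `Literature.NumberTheory.Automorphic.UnitaryRankThree`.  KERNEL only
(theorems, no definition, no notation, no named fact, no `sorry`).  Conclusion of `UnitaryRankThreeUnipotent` /
`UnitaryRankThreeTorus` (same setting: `K` a field with `2 ≠ 0`, `σ` an involution of `K`, `σ θ₀ = −θ₀ ≠ 0`,
`σ c = c ≠ 0`, `J₀ = !![0, 0, θ₀; 0, c, 0; -θ₀, 0, 0]`, `U = unitaryGroupOfForm σ J₀ ≤ GL₃(K)`).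

* `apply_eq_one_of_firstColumn` — the PARABOLIC step: an element of `U` of determinant `1` stabilising the
  isotropic line `K e` (first column `(p₀₀, 0, 0)`) is killed by every `χ : U →* A` (`P = T · N`, and unitarity
  forces `T ∩ SU = {diag(a, σ(a)/a, σ(a)⁻¹)}`);
* **`apply_eq_one_of_det_eq_one`** — the BIG CELL `U = N⁻ P ∪ w P` (an element with `g₀₀ ≠ 0` is `n⁻ p` with
  `n⁻ ∈ N⁻` matching its first column; one with `g₀₀ = 0` has first column `(0, 0, g₂₀)` by isotropy and is `w p`):
  EVERY element of `U` of determinant `1` is killed by every homomorphism `χ : U →* A` to a commutative group —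
  `SU(J₀) ≤ [U, U]`-style, the rank-3 Witt-index-1 case of `SU_n(K, f) = T_n(K, f)`
  [Dieudonne1971GroupesClassiques, Chap. II §5]; `apply_eq_one_of_det_eq_one'` is the same for any matrix `J`
  propositionally equal to `J₀` (consumed by the transport to diagonal isotropic forms).

## References

* J. Dieudonné, *La géométrie des groupes classiques*, 3e éd., Springer (1971), Chap. II §§4–5
  [Dieudonne1971GroupesClassiques].
-/

set_option autoImplicit false

open Matrix

namespace Literature.NumberTheory.Automorphic

namespace UnitaryRankThree

variable {K : Type*} [Field K] {σ : K →+* K} {θ₀ c : K} {A : Type*} [CommGroup A]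

/-! ## §0 Plumbing (as in Parts I–II) -/

/-- An invertible matrix satisfying the unitarity identity gives an element of `U` with that matrix. [folklore] -/
private theorem exists_val_eq (M : Matrix (Fin 3) (Fin 3) K) (hd : M.det ≠ 0)
    (hm : (M.map σ)ᵀ * (!![(0 : K), 0, θ₀; 0, c, 0; -θ₀, 0, 0] : Matrix (Fin 3) (Fin 3) K) * M =
      (!![(0 : K), 0, θ₀; 0, c, 0; -θ₀, 0, 0] : Matrix (Fin 3) (Fin 3) K)) :
    ∃ g : ↥(unitaryGroupOfForm σ !![(0 : K), 0, θ₀; 0, c, 0; -θ₀, 0, 0]), g.1.1 = M :=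
  ⟨⟨Matrix.GeneralLinearGroup.mkOfDetNeZero M hd, hm⟩, rfl⟩

/-- The matrix of a product. [folklore] -/
private theorem val_mul (g h : ↥(unitaryGroupOfForm σ !![(0 : K), 0, θ₀; 0, c, 0; -θ₀, 0, 0])) :
    (g * h).1.1 = g.1.1 * h.1.1 := rfl

/-- The matrix of an inverse, from a left inverse. [folklore] -/
private theorem val_inv_eq {g : ↥(unitaryGroupOfForm σ !![(0 : K), 0, θ₀; 0, c, 0; -θ₀, 0, 0])}
    {M' : Matrix (Fin 3) (Fin 3) K} (h : M' * g.1.1 = 1) : (g⁻¹).1.1 = M' := by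
  have e : (g⁻¹).1.1 = (g.1.1)⁻¹ := by rw [Subgroup.coe_inv, Matrix.coe_units_inv]
  rw [e]
  exact Matrix.inv_eq_left_inv h

/-- The membership identity of an element of `U`. [folklore] -/
private theorem val_mem (g : ↥(unitaryGroupOfForm σ !![(0 : K), 0, θ₀; 0, c, 0; -θ₀, 0, 0])) :
    (g.1.1.map σ)ᵀ * (!![(0 : K), 0, θ₀; 0, c, 0; -θ₀, 0, 0] : Matrix (Fin 3) (Fin 3) K) * g.1.1 =
      (!![(0 : K), 0, θ₀; 0, c, 0; -θ₀, 0, 0] : Matrix (Fin 3) (Fin 3) K) := g.2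

/-- Elements of `U` with the same matrix are equal. [folklore] -/
private theorem ext_val {g h : ↥(unitaryGroupOfForm σ !![(0 : K), 0, θ₀; 0, c, 0; -θ₀, 0, 0])}
    (e : g.1.1 = h.1.1) : g = h := Subtype.ext (Units.ext e)

/-- determinant of a diagonal matrix. [folklore] -/
private theorem det_diag (a u d : K) : (!![a, 0, 0; 0, u, 0; 0, 0, d] : Matrix (Fin 3) (Fin 3) K).det = a * u * d := by
  simp [Matrix.det_fin_three]

/-! ## §1 The parabolic step -/

section Chi

variable (hσ : ∀ x, σ (σ x) = x) (hθ : σ θ₀ = -θ₀) (hθ0 : θ₀ ≠ 0) (hc : σ c = c) (hc0 : c ≠ 0) (h2 : (2 : K) ≠ 0)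
include hσ hθ hθ0 hc hc0 h2

/-- **The parabolic step**: an element of `U` of determinant `1` whose first column is `(p₀₀, 0, 0)` (it stabilises
the isotropic line `K e`) is killed by `χ` — it is `t · n` with `n ∈ N` and `t = diag(a, σ(a)/a, σ(a)⁻¹)`.
[cite: Dieudonne1971GroupesClassiques, Chap. II §5] -/
theorem apply_eq_one_of_firstColumn (χ : ↥(unitaryGroupOfForm σ !![(0 : K), 0, θ₀; 0, c, 0; -θ₀, 0, 0]) →* A)
    (g : ↥(unitaryGroupOfForm σ !![(0 : K), 0, θ₀; 0, c, 0; -θ₀, 0, 0]))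
    (h10 : g.1.1 1 0 = 0) (h20 : g.1.1 2 0 = 0) (hdet : g.1.1.det = 1) : χ g = 1 := by
  set P := g.1.1 with hP_def
  have hP : P = !![P 0 0, P 0 1, P 0 2; 0, P 1 1, P 1 2; 0, P 2 1, P 2 2] := by
    ext i j
    fin_cases i <;> fin_cases j <;> simp [h10, h20]
  have hmem := val_mem g
  rw [← hP_def] at hmem
  rw [hP] at hmem hdet
  have h01 := congrFun (congrFun hmem 0) 1
  have h02 := congrFun (congrFun hmem 0) 2
  have h11 := congrFun (congrFun hmem 1) 1
  simp [Matrix.mul_apply, Fin.sum_univ_three] at h01 h02 h11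
  rw [Matrix.det_fin_three] at hdet
  simp at hdet
  -- `P 0 0 ≠ 0`
  have hP00 : P 0 0 ≠ 0 := by
    intro h
    rw [h] at hdet
    simp at hdet
  have hσP00 : σ (P 0 0) ≠ 0 := fun h => hP00 (by simpa [hσ] using congrArg σ h)
  -- `P 2 1 = 0`
  have hP21 : P 2 1 = 0 := by
    rcases h01 with (h | h) | h
    · exact absurd h hP00
    · exact absurd h hθ0
    · exact h
  -- `σ(P 0 0) P 2 2 = 1`
  have hP22 : σ (P 0 0) * P 2 2 = 1 := by
    have : σ (P 0 0) * θ₀ * P 2 2 = θ₀ * 1 := by rw [mul_one]; exact h02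
    have : θ₀ * (σ (P 0 0) * P 2 2) = θ₀ * 1 := by rw [← this]; ring
    exact mul_left_cancel₀ hθ0 this
  have hP22' : P 2 2 = (σ (P 0 0))⁻¹ := eq_inv_of_mul_eq_one_right hP22
  -- `P 1 1 σ(P 1 1) = 1`
  rw [hP21] at h11 hdet
  simp at h11 hdet
  have hN11 : P 1 1 * σ (P 1 1) = 1 := by
    have : c * (P 1 1 * σ (P 1 1)) = c * 1 := by rw [mul_one]; linear_combination h11
    exact mul_left_cancel₀ hc0 this
  have hP11_0 : P 1 1 ≠ 0 := fun h => by rw [h, zero_mul] at hN11; exact zero_ne_one hN11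
  -- `P 1 1 = σ(P 0 0)/P 0 0` from `det = 1`
  have hP11 : P 1 1 = σ (P 0 0) / P 0 0 := by
    rw [hP22'] at hdet
    field_simp at hdet
    field_simp
    linear_combination hdet
  -- the torus part `t` and the unipotent part `t⁻¹ g`
  obtain ⟨t, ht⟩ := exists_val_eq (σ := σ) (θ₀ := θ₀) (c := c) !![P 0 0, 0, 0; 0, P 1 1, 0; 0, 0, (σ (P 0 0))⁻¹]
    (by rw [det_diag]; exact mul_ne_zero (mul_ne_zero hP00 hP11_0) (inv_ne_zero hσP00))
    (diag_mem hσ (P 0 0) (P 1 1) hP00 hN11)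
  have hti : (t⁻¹).1.1 = !![(P 0 0)⁻¹, 0, 0; 0, (P 1 1)⁻¹, 0; 0, 0, σ (P 0 0)] := by
    refine val_inv_eq ?_
    rw [ht]
    ext i j
    fin_cases i <;> fin_cases j <;> simp [Matrix.mul_apply, Fin.sum_univ_three, hP00, hP11_0, hσP00]
  have hu : (t⁻¹ * g).1.1 = !![(1 : K), (P 0 0)⁻¹ * P 0 1, (P 0 0)⁻¹ * P 0 2; 0, 1, (P 1 1)⁻¹ * P 1 2; 0, 0, 1] := by
    rw [val_mul, hti, ← hP_def, hP, hP21, hP22']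
    ext i j
    fin_cases i <;> fin_cases j <;> simp [Matrix.mul_apply, Fin.sum_univ_three, hP00, hP11_0, hσP00]
  have hχu : χ (t⁻¹ * g) = 1 := apply_eq_one_of_val_eq_upper hσ hθ hθ0 hc h2 χ _ _ _ _ hu
  have hχt : χ t = 1 := by
    refine apply_eq_one_of_val_eq_diagSU hσ hθ hθ0 hc hc0 h2 χ t (P 0 0) hP00 ?_
    rw [ht, hP11]
  have : g = t * (t⁻¹ * g) := by group
  rw [this, map_mul, hχt, hχu, one_mul]

/-! ## §2 The big cell and the main theorem -/

/-- **`SU(J₀) ≤ ker χ`**: every element of determinant `1` of the unitary group of the standard rank-3 isotropic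
`σ`-hermitian form `J₀ = !![0, 0, θ₀; 0, c, 0; -θ₀, 0, 0]` is killed by every homomorphism to a commutative group
(big cell `U = N⁻ P ∪ w P`). [cite: Dieudonne1971GroupesClassiques, Chap. II §5] -/
theorem apply_eq_one_of_det_eq_one (χ : ↥(unitaryGroupOfForm σ !![(0 : K), 0, θ₀; 0, c, 0; -θ₀, 0, 0]) →* A)
    (g : ↥(unitaryGroupOfForm σ !![(0 : K), 0, θ₀; 0, c, 0; -θ₀, 0, 0])) (hdet : g.1.1.det = 1) : χ g = 1 := by
  set G := g.1.1 with hG_def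
  have hmem := val_mem g
  rw [← hG_def] at hmem
  have h00 := congrFun (congrFun hmem 0) 0
  simp [Matrix.mul_apply, Fin.sum_univ_three] at h00
  -- the Weyl element
  obtain ⟨w, hw⟩ := exists_val_eq (σ := σ) (θ₀ := θ₀) (c := c) !![(0 : K), 0, -1; 0, 1, 0; 1, 0, 0]
    (by simp [Matrix.det_fin_three]) weyl_mem
  have hwi : (w⁻¹).1.1 = !![(0 : K), 0, 1; 0, 1, 0; -1, 0, 0] := by
    refine val_inv_eq ?_
    rw [hw]
    ext i j
    fin_cases i <;> fin_cases j <;> simp [Matrix.mul_apply, Fin.sum_univ_three]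
  by_cases hG00 : G 0 0 = 0
  · -- first column `(0, 0, g₂₀)`: `g = w p`
    have hG10 : G 1 0 = 0 := by
      rw [hG00, map_zero] at h00
      simp at h00
      rcases h00 with (h | h) | h
      · exact h
      · exact absurd h hc0
      · exact h
    have hp10 : (w⁻¹ * g).1.1 1 0 = 0 := by
      rw [val_mul, hwi, ← hG_def]; simp [Matrix.mul_apply, Fin.sum_univ_three, hG10]
    have hp20 : (w⁻¹ * g).1.1 2 0 = 0 := by
      rw [val_mul, hwi, ← hG_def]; simp [Matrix.mul_apply, Fin.sum_univ_three, hG00]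
    have hpdet : (w⁻¹ * g).1.1.det = 1 := by
      rw [val_mul, hwi, Matrix.det_mul, ← hG_def, hdet]; simp [Matrix.det_fin_three]
    have hχp := apply_eq_one_of_firstColumn hσ hθ hθ0 hc hc0 h2 χ _ hp10 hp20 hpdet
    have hχw := apply_eq_one_of_val_eq_weyl hσ hθ hθ0 hc h2 χ w hw
    have : g = w * (w⁻¹ * g) := by group
    rw [this, map_mul, hχw, hχp, one_mul]
  · -- `g₀₀ ≠ 0`: `g = n⁻ p` with `n⁻ ∈ N⁻` matching the first column of `g`
    have hσG00 : σ (G 0 0) ≠ 0 := fun h => hG00 (by simpa [hσ] using congrArg σ h)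
    set β : K := G 1 0 / G 0 0 with hβ
    set ζ : K := G 2 0 / G 0 0 with hζ
    have hy : θ₀ * (σ (-ζ) - -ζ) = -(c * (-β * σ (-β))) := by
      rw [hζ, hβ, map_neg, map_neg, map_div₀, map_div₀]
      field_simp
      linear_combination h00
    obtain ⟨u₁, hu₁⟩ := exists_val_eq (σ := σ) (θ₀ := θ₀) (c := c)
      !![(1 : K), c * σ (-β) / θ₀, -ζ; 0, 1, -β; 0, 0, 1] (by simp [Matrix.det_fin_three])
      (upper_mem hσ hθ hθ0 hc _ (-β) (-ζ) rfl hy)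
    have hn : (w * u₁ * w⁻¹).1.1 = !![(1 : K), 0, 0; β, 1, 0; ζ, c * σ (-β) / θ₀, 1] := by
      rw [val_mul, val_mul, hw, hu₁, hwi]
      ext i j
      fin_cases i <;> fin_cases j <;> simp [Matrix.mul_apply, Fin.sum_univ_three]
    have hχn : χ (w * u₁ * w⁻¹) = 1 := apply_eq_one_of_val_eq_lower hσ hθ hθ0 hc h2 χ _ _ _ _ hn
    -- `p := n⁻¹ g` has first column `(g₀₀, 0, 0)` and determinant `1`
    have hnp : (w * u₁ * w⁻¹).1.1 * ((w * u₁ * w⁻¹)⁻¹ * g).1.1 = G := by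
      rw [← val_mul, mul_inv_cancel_left]
    rw [hn] at hnp
    set P := ((w * u₁ * w⁻¹)⁻¹ * g).1.1 with hP
    have e1 := congrFun (congrFun hnp 1) 0
    have e2 := congrFun (congrFun hnp 2) 0
    have e0 := congrFun (congrFun hnp 0) 0
    simp [Matrix.mul_apply, Fin.sum_univ_three] at e0 e1 e2
    have hp10 : P 1 0 = 0 := by
      rw [e0] at e1
      rw [hβ] at e1
      field_simp at e1
      linear_combination e1
    have hp20 : P 2 0 = 0 := by
      rw [e0, hp10] at e2
      rw [hζ] at e2
      field_simp at e2
      have h' : θ₀ * P 2 0 = 0 := by linear_combination e2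
      rcases mul_eq_zero.1 h' with h | h
      · exact absurd h hθ0
      · exact h
    have hpdet : P.det = 1 := by
      have := congrArg Matrix.det hnp
      rw [Matrix.det_mul, hdet] at this
      simpa [Matrix.det_fin_three] using this
    have hχp := apply_eq_one_of_firstColumn hσ hθ hθ0 hc hc0 h2 χ _ hp10 hp20 hpdet
    have : g = (w * u₁ * w⁻¹) * ((w * u₁ * w⁻¹)⁻¹ * g) := by group
    rw [this, map_mul, hχn, hχp, one_mul]

/-- Hypothesis form of `apply_eq_one_of_det_eq_one` for a matrix `J` propositionally equal to `J₀` (used by the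
transport along a Witt frame, `UnitaryRankThreeDiagonal`). [cite: Dieudonne1971GroupesClassiques, Chap. II §5] -/
theorem apply_eq_one_of_det_eq_one' (J : Matrix (Fin 3) (Fin 3) K) (hJ : J = !![(0 : K), 0, θ₀; 0, c, 0; -θ₀, 0, 0])
    (χ : ↥(unitaryGroupOfForm σ J) →* A) (g : ↥(unitaryGroupOfForm σ J)) (hdet : g.1.1.det = 1) : χ g = 1 := by
  subst hJ
  exact apply_eq_one_of_det_eq_one hσ hθ hθ0 hc hc0 h2 χ g hdet

end Chi

end UnitaryRankThree

end Literature.NumberTheory.Automorphic
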